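import Mathlib
import Summits.Ventures.PercRepro2.CrossAPrimePendantReduce

/-!
# A leaf mark scales: `b` with the single edge `{b, w}` has `crossA′so(o, b) = β·crossA′so(o, w)`
(blind cell PercRepro2, p5 g37; S4 §2.4 (s) addendum 44 (3))

If the mark `b` has exactly ONE edge `f = {b, w}` (weight `β`, `w ≠ a₂`), then `b ∈ K ⟺ f` open
and `w ∈ K`, and `f` is invisible to `Q`, `o ∈ K`, `a₁ ↔ v`, `w ∈ K` (the isolated-vertex flip), so
every mass with `b` is `β` times the mass with `w`: **`crossA'so_leaf_mark`**
`crossA′so p (o, b) = p f · crossA′so p (o, w)` — the degree-one mark reduces EXACTLY to its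
neighbour, at the same measure and the same constant `π`.  With `crossA'so_swap` the same for `o`.
(`w = a₂` is the independent mark, `CrossAPrimeIndepMark`.)  Own work; standard axioms.
-/

namespace Summit.Ventures.PercRepro2

open LeafRowPendantRootSO CrossAPrimeA2Route CrossAPrimeSupport CrossAPrimeIsolatedFlip
  CrossAPrimePendantReduce

namespace CrossAPrimeLeafMark

variable {V : Type*} {E : Type*} [Fintype E] [DecidableEq E] {R : Type*} [Field R]
variable {ends : E → Sym2 V}

/-- For a leaf mark `b` (single edge `f = {b, w}`) and an event `A` invisible to `f` at the isolated
`b`, `P(A ∩ {b ∈ K}) = p f · P(A ∩ {w ∈ K})`. -/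
lemma prob_leaf_bH (p : E → R) {f : E} {a₂ b w : V} (hf : ends f = s(b, w))
    (hb : ∀ e, b ∈ ends e → e = f) (hba₂ : a₂ ≠ b) (A : Set (Config E))
    (hA : ∀ ω : Config E, (∀ e, b ∈ ends e → ω e = false) →
      (Function.update ω f true ∈ (A ∩ connEvent ends a₂ w) ↔ ω ∈ (A ∩ connEvent ends a₂ w))) :
    prob p (A ∩ connEvent ends a₂ b) = p f * prob p (A ∩ connEvent ends a₂ w) := by
  have hz : ∀ e', b ∈ ends e' → e' ≠ f → p e' = 0 := fun e' he' hne => absurd (hb e' he') hne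
  -- `b ∈ K` forces `f` open: under `p[f ↦ 0]` the event is empty
  have h0 : prob (Function.update p f 0) (A ∩ connEvent ends a₂ b) = 0 := by
    rw [← prob_inter_supp]
    have : A ∩ connEvent ends a₂ b ∩ supp (Function.update p f 0) = ∅ := by
      ext ω
      refine ⟨fun h => ?_, fun h => absurd h (Set.notMem_empty ω)⟩
      obtain ⟨⟨-, hbK⟩, hs⟩ := h
      have hiso : ∀ e, b ∈ ends e → ω e = false := by
        intro e he
        rw [hb e he]
        exact (hs f).2 (by simp)
      exact (hba₂ (eq_of_conn_of_isolated (ends := ends) hiso (conn_symm hbK))).elim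
    rw [this, prob_empty]
  -- under `p[f ↦ 1]`, `b ∈ K ⟺ w ∈ K`
  have h1 : prob (Function.update p f 1) (A ∩ connEvent ends a₂ b) =
      prob (Function.update p f 1) (A ∩ connEvent ends a₂ w) := by
    apply prob_congr_supp
    ext ω
    simp only [Set.mem_inter_iff]
    have hbw : ω ∈ supp (Function.update p f 1) → Conn ends ω b w := fun hs =>
      conn_of_openAdj ⟨f, (hs f).1 (by simp), hf⟩
    constructor
    · rintro ⟨⟨hA', hbK⟩, hs⟩
      exact ⟨⟨hA', conn_trans hbK (hbw hs)⟩, hs⟩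
    · rintro ⟨⟨hA', hwK⟩, hs⟩
      exact ⟨⟨hA', conn_trans hwK (conn_symm (hbw hs))⟩, hs⟩
  -- the flip at the isolated `b` is invisible to `A ∩ {w ∈ K}`
  have hflip : prob (Function.update p f 1) (A ∩ connEvent ends a₂ w) =
      prob (Function.update p f 0) (A ∩ connEvent ends a₂ w) :=
    prob_update_one_eq_update_zero_of_isolated (ends := ends) p hz hA
  have e1 := prob_eq_pin p (A ∩ connEvent ends a₂ b) f
  have e2 := prob_eq_pin p (A ∩ connEvent ends a₂ w) f
  rw [h0, h1, hflip] at e1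
  rw [hflip] at e2
  rw [e1, e2]
  ring

/-- **A leaf mark scales**: `b` with exactly the edge `f = {b, w}`, `b ∉ {o, a₁, a₂, v, w}`:
`crossA′so p (o, b) = p f · crossA′so p (o, w)`. -/
theorem crossA'so_leaf_mark (p : E → R) {f : E} {o a₁ a₂ v b w : V} (hf : ends f = s(b, w))
    (hb : ∀ e, b ∈ ends e → e = f) (hba₁ : a₁ ≠ b) (hba₂ : a₂ ≠ b) (hbo : o ≠ b) (hbv : v ≠ b)
    (hbw : w ≠ b) :
    crossA'so p ends o a₁ a₂ v b = p f * crossA'so p ends o a₁ a₂ v w := by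
  have flipf : ∀ ω : Config E, (∀ e, b ∈ ends e → ω e = false) →
      ((Function.update ω f true ∈ avoidAll ends a₂ {a₁} ↔ ω ∈ avoidAll ends a₂ {a₁}) ∧
        (Function.update ω f true ∈ connEvent ends a₂ o ↔ ω ∈ connEvent ends a₂ o) ∧
        (Function.update ω f true ∈ connEvent ends a₁ v ↔ ω ∈ connEvent ends a₁ v) ∧
        (Function.update ω f true ∈ connEvent ends a₂ w ↔ ω ∈ connEvent ends a₂ w)) :=
    fun ω hiso => flipf_iff_of_isolated (o := o) (v := v) (a₂ := a₂) hf hiso hba₁ hba₂ hbo hbv hbw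
  set Q := avoidAll ends a₂ {a₁}
  set oH := connEvent ends a₂ o
  set L := connEvent ends a₁ v
  have hy : prob p (Q ∩ connEvent ends a₂ b) = p f * prob p (Q ∩ connEvent ends a₂ w) :=
    prob_leaf_bH (ends := ends) p hf hb hba₂ Q (fun ω hiso => by
      simp only [Set.mem_inter_iff, (flipf ω hiso).1, (flipf ω hiso).2.2.2])
  have hyv : prob p (Q ∩ (L ∩ connEvent ends a₂ b)) =
      p f * prob p (Q ∩ (L ∩ connEvent ends a₂ w)) := by
    rw [← Set.inter_assoc, ← Set.inter_assoc]
    exact prob_leaf_bH (ends := ends) p hf hb hba₂ (Q ∩ L) (fun ω hiso => by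
      simp only [Set.mem_inter_iff, (flipf ω hiso).1, (flipf ω hiso).2.2.1, (flipf ω hiso).2.2.2])
  have hDv : prob p (Q ∩ (L ∩ (oH ∩ connEvent ends a₂ b))) =
      p f * prob p (Q ∩ (L ∩ (oH ∩ connEvent ends a₂ w))) := by
    rw [← Set.inter_assoc, ← Set.inter_assoc, ← Set.inter_assoc, ← Set.inter_assoc]
    exact prob_leaf_bH (ends := ends) p hf hb hba₂ (Q ∩ L ∩ oH) (fun ω hiso => by
      simp only [Set.mem_inter_iff, (flipf ω hiso).1, (flipf ω hiso).2.1, (flipf ω hiso).2.2.1,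
        (flipf ω hiso).2.2.2])
  unfold crossA'so
  rw [hy, hyv, hDv]
  ring

end CrossAPrimeLeafMark

end Summit.Ventures.PercRepro2
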